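import Literature.NumberTheory.EllipticCurves.Castella2018.AnticyclotomicSelmerDual
import Literature.NumberTheory.EllipticCurves.PadicFormalLogOrder
import Literature.NumberTheory.EllipticCurves.Rank1Residual.Predicates
import Literature.NumberTheory.EllipticCurves.HeegnerPoints
import Literature.NumberTheory.EllipticCurves.Sha
import Literature.NumberTheory.EllipticCurves.BSDConductor
import HarnessLib

/-!
# Jetchev–Skinner–Wan 2017, Thm. 3.3.1 with (3.5.d): the ANTICYCLOTOMIC CONTROL THEOREM for an
# elliptic curve over `ℚ` at a GOOD prime `p ≥ 3` split in `K`, with `E[p]` an irreducible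
# `G_K`-module — a named fact ON THE LITERATURE OBJECT `X_ac` (anomalous `p` and supersingular `p`
# allowed: no ordinarity and no `E(ℚ_p)[p] = 0` hypothesis)

HONEST FRAMING (cell `b2b-bsdres`, run/shared/lean/b2b/bsd-rank1-residual/; page 1 everywhere):
the goal of the cell is to DELETE the COMBINATION-SHAPED residual classes of the BSD formula for ALL
analytic-rank `≤ 1` curves over `ℚ` from PUBLISHED theorems only, so that the remainder becomes
exactly the CONSTRUCTION-SHAPED classes, which are TYPED, not attempted; this is not "finishing
BSD". This file vendors ONE published statement as a named fact (`def … : Prop`, nothing asserted;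
D-0014/D-0026) and PROVES its bookkeeping consumers. Unit `b2b-bsdres-lit-glue` (GLUE seat, gen 6).

## What and why

The covered irreducible rank-one rows of the cell (C2 `r = 1`, C3-ordinary, C16 `r = 1`) stand, at
main-conjecture level, on two links per anticyclotomic datum on the constructed `Λ`-module `X_ac`:
(IMC≥∘BDP)ᵍ and the CONTROL link (CTL)ᵍ (`Summits/…/Partition/MainConjecturesAnticyclotomicGood.lean`).
Off the anomalous line `a_p ≢ 1 (mod p)` the control link is already FED by a published fact —
Castella–Grossi–Lee–Skinner 2022 Thm. 5.1.1 (`CastellaGrossiLeeSkinner2022/AnticyclotomicControl.lean`,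
hypothesis `E(ℚ_p)[p] = 0`). The source theorem of CGLS 5.1.1's printed proof — Jetchev–Skinner–Wan
2017 Thm. 3.3.1 with the elliptic-curve evaluation (3.5.d) — has NO `E(ℚ_p)[p] = 0` and NO
ordinarity hypothesis (it assumes instead that `E[p]` is an irreducible `G_K`-module), so it serves
the ANOMALOUS irreducible pairs and the SUPERSINGULAR pairs (class X6, row C3 ∩ {`p ∣ a_p`}) as
well. This file vendors it, verbatim, on the same Literature object.

## Citation header (read by this seat on the store's LaTeXML text of arXiv:1512.06894 = the
## accepted manuscript of the version of record; `paper:arxiv-1512.06894`, chunks p0007, p0010–p0016,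
## p0026–p0027, p0029–p0030; arXiv theorem numbers in brackets)

* Authors: Dimitar Jetchev, Christopher Skinner, Xin Wan.
* Title: *The Birch and Swinnerton-Dyer formula for elliptic curves of analytic rank one*.
* Venue: Camb. J. Math. **5** (2017), no. 3, 369–434, doi:10.4310/CJM.2017.v5.n3.a2
  (= arXiv:1512.06894; bib key `JetchevSkinnerWan2017`). REFEREED / PUBLISHED.
* Standing setting (verbatim). §2.1 (p. 6): "Throughout, let `p ≥ 3` be a fixed prime". §3 (p. 10):
  "Let `𝒦/ℚ` be an imaginary quadratic field such that `p` splits in `𝒦`: `p = v v̄` (split). …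
  Let `𝒦_∞` be the anticyclotomic `ℤ_p`-extension of `𝒦` and let `Γ = Gal(𝒦_∞/𝒦)`. … Let
  `Λ = 𝒪⟦Γ⟧` and put `M = T ⊗_𝒪 Λ^`, `Λ^ = Hom_cont(Λ, ℚ_p/ℤ_p)`. We equip `M` with an action of
  `G_𝒦` via `ρ ⊗ Ψ⁻¹` … Given a finite set `Σ` of finite places `w ∤ p`, let
  `X_ac^Σ(M) = Hom_𝒪(H¹_{𝓕_ac^Σ}(𝒦, M), L/𝒪)`." §2.3.3 (p. 7): the anticyclotomic Selmer structure
  "`H¹_{𝓕_ac}(𝒦_w, M) = H¹(𝒦_v̄, M)` if `w = v̄`; `H¹_ur(𝒦_w, M)` if `w ∤ p∞` is split; `0` else"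
  (so: STRICT at `v`, relaxed at `v̄`). §3.3 (p. 11): "Let `S` be a finite set of places of `𝒦`
  including all those at which `V` is ramified and let `S_p ⊂ S` be the subset of those not
  dividing `p`. Let `Σ ⊂ S_p`. Fix a topological generator `γ ∈ Γ`. We identify `𝒪⟦T⟧` with
  `Λ = 𝒪⟦Γ⟧` via … `1 + T ↦ γ`."
* **Theorem 3.3.1** [arXiv Thm. 8, p. 11] (Anticyclotomic Control Theorem), verbatim: "The
  `Λ`-module `X_ac^Σ(M)` is `Λ`-torsion, and if `f_ac^Σ(T)` is a generator of its characteristic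
  `Λ`-ideal `Ch(X_ac^Σ(M))`, then `#𝒪/f_ac^Σ(0) = #H¹_{𝓕_ac}(𝒦, W) · C^Σ(W)`, where
  `C^Σ(W) = #H⁰(𝒦_v, W) · #H⁰(𝒦_v̄, W) · ∏_{w ∈ S_p∖Σ, w split} #H¹_ur(𝒦_w, W) · ∏_{w∈Σ} #H¹(𝒦_w, W)`."
  It is proved under the assumptions of §3.1 (p. 10): (geom), (pure), (sst) "`V` is semistable as a
  representation of `G_{𝒦_w}` for all `w ∣ p`", (τ-dual), (2-dim), (HT), **(irred_𝒦) "`V̄` is an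
  irreducible `κ`-representation of `G_𝒦`"**, (corank 1), (sur). §3.3.3 [arXiv Prop. 11, p. 12]:
  "`c_w^{(p)}(W) := [H¹_ur(𝒦_w, W) : H¹_f(K_w, W)] = #H¹_ur(𝒦_w, W)` are the `p`-parts of the local
  Tamagawa numbers."
* **§3.5, display (3.5.d)** [arXiv p. 16, the display (eq:modabvar-ec) closing §3.5], verbatim: "In
  the special case that `A_f = E` is an elliptic curve (i.e., `f` has rational coefficients), `p` is
  a prime of good reduction, `𝒪 = ℤ_p`, and `P ∈ E(𝒦)` has infinite order, …
  `#H¹_{𝓕_ac}(𝒦, E[p^∞]) = #Ш(E/𝒦)[p^∞] · ( #ℤ_p/((1−a_p(E)+p)/p · log_{ω_E} P) /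
  ([E(𝒦):ℤ·P]_p · #H⁰(𝒦_v, E[p^∞])) )²`" — `log_{ω_E}` the formal-group logarithm on `E(𝒦_v)`,
  `𝒦_v = ℚ_p`, for the Néron differential `ω_E` (p. 15–16); derived (§3.5, pp. 15–16) under (split),
  (good) `p ∤ N`, **(rank 1) `rank_ℤ E(𝒦) = 1`**, **(Ш 𝔭-finite) `#Ш(E/𝒦)[p^∞] < ∞`**, **(𝔭-irred)
  "`A_f[𝔭]` is an irreducible `G_𝒦`-representation"**, which imply (corank 1), (sur), (irred_𝒦)
  ("This shows that if (split), (rank 1), (Ш-finite), and (𝔭-irred) hold, then so do (crk 1),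
  (surj_p), and (irred_𝒦)"); for `E/ℚ` and `p ∤ N`, (geom), (pure), (τ-dual), (2-dim) hold by
  Saito/Deligne/Carayol, (sst) by `ord_p(N) ≤ 1`, and "(HT) always holds for `2k = 2`" (§3.5 p. 15).
  NO ordinarity hypothesis ("`A_f[𝔭^∞](𝔽_p)` … is trivial unless `f` is ordinary … Hence
  `#A_f(ℚ_p)/A_f^1(ℚ_p) ⊗ 𝒪 = #𝒪/(1 − a_p + p)`" in either case) and NO `E(ℚ_p)[p] = 0` hypothesis.
* The combination, as the authors use it (§7.4.1, p. 30, for `𝒦 = 𝒦'`): "it follows from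
  (eq:modabvar-ec) and the definition of `C(E[p^∞])` that `ord_p(#H¹_{𝓕_ac}(𝒦', E[p^∞]) ·
  C(E[p^∞])) = ord_p(#Ш(E/𝒦')) − 2·ord_p(m_{𝒦'}) + 2·ord_p((1+p−a_p)/p · log_{ω_E}(z_{𝒦'})) +
  ord_p(∏_{w∣N⁺} c_w(E/𝒦'))`" (the two `#H⁰(𝒦_v, E[p^∞]) = #H⁰(𝒦_v̄, E[p^∞]) = #E(ℚ_p)[p^∞]`
  cancel). With Thm. 3.3.1 (`Σ = ∅`): `ord_p f_ac(0) = ord_p #Ш(E/𝒦)[p^∞] + 2·(ord_p((1−a_p+p)/p ·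
  log_{ω_E} P) − ord_p [E(𝒦):ℤP]) + ord_p ∏_{w∣N, w split} c_w(E/𝒦)`. The same statement in the
  later literature: Castella, Camb. J. Math. 6 (2018) Thm. 2.3 (with `ε_p`; "this follows easily
  from the 'Anticyclotomic Control Theorem' established in [JSW]"); Castella–Grossi–Lee–Skinner,
  Invent. Math. 227 (2022) Thm. 5.1.1 (`E(ℚ_p)[p] = 0` in place of (irred_𝒦); "This follows from
  the combination of Theorem 3.3.1 and equation (3.5.d) in [JSW]").

## Transcription (tree vocabulary; every symbol a Literature object) — SPECIAL CASE VENDORED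

* "`E/ℚ`, `p ≥ 3`, `p ∤ N`" = a globally minimal `W` (so `a_p = W.frobeniusTrace p` and
  `ω = dx/(2y + a₁x + a₃)` is a Néron differential), `3 ≤ p`, `Rank1Residual.Good W p`.
* "`𝒦` imaginary quadratic, `p = v v̄` splits" = `IsImaginaryQuadratic K`,
  `SatisfiesHeegnerHypothesis p K`.
* **Special case**: the fact is vendored for `𝒦` with EVERY `ℓ ∣ N` SPLIT
  (`SatisfiesHeegnerHypothesis (W.conductorNorm ℤ) K`, the classical Heegner hypothesis — the
  currency of every consumer in the cell at a good `p`), where `∏_{w ∈ S_p, w split} c_w^{(p)}(W) =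
  ∏_{w∣N} c_w(E/𝒦)_p` is transcribed as the `p`-part of the tree's full Tamagawa product
  `(W.baseChange K).tamagawaProduct` (`c_w = 1` off `N`) — the reading already used for CGLS 5.1.1,
  A157 and JSW (eq:shalowerK-1) in the cell.
  -- TODO(general form): for a general `𝒦` (non-split primes dividing `N` allowed, JSW's (gen-H))
  -- the Tamagawa factor is `∏_{w∣N, w split in 𝒦} c_w(E/𝒦)` ("`∏_{w∣N⁺} c_w`"); the tree's only
  -- object for it (`X11b.tamagawaProductSplit`) lives under `Summits/` (multr1) and must be re-homed
  -- to Literature before the general statement can be vendored (lit-cgls S14).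
* "`v` (the STRICT prime; `log_{ω_E}` on `E(𝒦_v)`)" = an embedding `ι : K →+* ℚ_[p]` and the prime
  `v` with `x ∈ v ⟺ ‖ι x‖ < 1` on `𝓞 K` (JSW's `v`, at which `𝓕_ac` is `0` and `δ_v` is computed,
  §3.2 Prop. 3.2.1 [arXiv Prop. 6]); `ord_p log_{ω_E} P = padicLogOrd W p ι P`
  (`PadicFormalLogOrder.lean`). This is Castella 2018's convention (log at the strict prime `𝔭`),
  NOT CGLS 2022's letter (log at the relaxed prime) — see `CGLS-CTL-log-prime` in lit-cgls §12.2.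
* "`𝒦_∞`, `γ`, `Λ = 𝒪⟦T⟧`, `1 + T ↦ γ`" = an anticyclotomic `κ : ZpExtension K p`
  (`κ.IsAnticyclotomic`), a topological generator `γ` (`[Fact (κ.IsTopGenerator γ)]`),
  `IwasawaAlgebra p`.
* "`X_ac(M) = X_ac^∅(M)`" = `AcSelmer.XAc (W.baseChange K) p κ v ∅ γ` — Castella 2018 Def. 2.2's
  `X_ac(E[p^∞])` with strict prime `𝔭 = v`, `Σ = ∅`, in the `K_∞`-formulation
  (`Castella2018/AnticyclotomicSelmer.lean`): strict above `v`, relaxed above `v̄`, locally trivial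
  above every finite `w ∤ p`. READING CAVEAT (flag offered `JSW-331-Kinf-formulation`, the same
  definition-level reading as `CGLS-CTL-Kinf-formulation` and multr1's X11b object): JSW's
  `H¹_{𝓕_ac}(𝒦, T ⊗ Λ^)` is identified with the `K_∞`-level group by Shapiro's lemma; JSW's
  condition "`0`" at the non-split `w ∤ p` and at `v` IS the tree's "locally trivial"/strict
  condition; JSW's "`H¹_ur`" at a split `w ∤ p` equals "locally trivial" over `K_∞` because a split
  `w` is finitely decomposed in `K_∞/K` (so `K_{∞,η} ⊇` the unramified `ℤ_p`-extension of `𝒦_w` and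
  `H¹_ur(K_{∞,η}, E[p^∞]) = H¹(Ẑ/ℤ_p, ·) = 0`).
* **(irred_𝒦)** = `(W.baseChange K).HasIrreducibleModPGaloisRep p` (the tree's irreducibility
  predicate for the curve over `K`: the only `Γ_K`-stable subgroups of `E[p] = E(K̄)[p]` are `⊥`,
  `⊤` — exactly "`E[p]` is an irreducible `𝔽_p`-representation of `G_𝒦`"). In print it follows
  from (irr) over `ℚ` together with `ρ̄_{E,p}` ramified at some `q ∥ N` (Skinner, Ann. Math. 191
  (2020) Lemma 2.8.1 [arXiv:1405.7294 Lemma 12]; JSW §7.4.1 p. 30) or from surjectivity of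
  `ρ̄_{E,p}` (the image of `G_𝒦` then contains `SL₂(𝔽_p)`); neither implication is vendored here.
* "`rank_ℤ E(𝒦) = 1`" = `(W.baseChange K).mordellWeilRank = 1`; "`#Ш(E/𝒦)[p^∞] < ∞`" =
  `Finite (primaryComponent (W.baseChange K).sha p)`; "`P` of infinite order" = `¬ IsOfFinAddOrder P`.
* Conclusion, with `#ℤ_p/(x) = p^{ord_p x}`: `X_ac` is `Λ`-torsion, `Ch = (f)` for some `f` with
  `f(0) ≠ 0`, and `ord_p f(0) = ord_p #Ш(E/𝒦)[p^∞] + 2·((ord_p(1−a_p+p) − 1 + ord_p log_{ω_E} P) −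
  ord_p[E(𝒦):ℤ·P]) + ord_p ∏_w c_w(E/𝒦)` (`[E(𝒦):ℤ·P] = (AddSubgroup.zmultiples P).index`). "If
  `f_ac(T)` is a generator" is read as the existence of such a generator; that EVERY generator then
  has the same `ord_p f(0)` is PROVED below (`thm331_padicVal_eq_of_generator`).

## Contents

* `thm331_anticyclotomicControl` — the named fact (ONE new `def … : Prop`).
* PROVED: `hasCharValuationAt_of_thm331` (the packaged currency `AcSelmer.XAc.HasCharValuationAt … n
  ∧ n = …` — LITERALLY the body shape of the Summits predicate `X11b.ControlOnTreeGoodAt p κ v γ ι P`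
  up to the Tamagawa reading), `thm331_padicVal_eq_of_generator`, `logOrd_sub_index_eq_of_thm331`.

## References
* [JetchevSkinnerWan2017] Camb. J. Math. 5 (2017) = arXiv:1512.06894: §2.1, §2.3.3, §3 (setting),
  §3.1 (assumptions), Thm. 3.3.1 [arXiv Thm. 8], §3.3.3 [arXiv Prop. 11], §3.5 (3.5.d) [arXiv
  (eq:modabvar-ec)], §7.4.1 (the combination).
* [CastellaGrossiLeeSkinner2022] Invent. Math. 227 (2022) Thm. 5.1.1 and its proof (the same
  statement with `E(ℚ_p)[p] = 0`); tree `CastellaGrossiLeeSkinner2022/AnticyclotomicControl.lean`.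
* [Castella2018] Camb. J. Math. 6 (2018): Def. 2.2, Thm. 2.3 — the object and the same theorem with
  `ε_p`; Literature object `Castella2018/AnticyclotomicSelmer{,Dual}.lean`.
* [Skinner2020] Ann. Math. 191 (2020) §2.8 Lemma 2.8.1 [arXiv:1405.7294 Lemma 12]
  ((irr) + (res) ⇒ (irr_𝒦)) — background for the (irred_𝒦) binder, not vendored.
* HOME/b2b-bsdres-lit-glue/GLUE.md §G5.4 / GEN 6 ADDENDUM; HOME/b2b-bsdres-lit-cgls/CGLS-GV-TYPING.md
  §12.10–12.11 (S13/S14).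
-/

set_option autoImplicit false

noncomputable section

open scoped Classical

open WeierstrassCurve NumberField IsDedekindDomain Field Literature.NumberTheory.EllipticCurves
  Literature.NumberTheory.EllipticCurves.Rank1Residual
  Literature.NumberTheory.EllipticCurves.Castella2018

namespace Literature.NumberTheory.EllipticCurves.JetchevSkinnerWan2017

/-- **Jetchev–Skinner–Wan, Camb. J. Math. 5 (2017) = arXiv:1512.06894, Theorem 3.3.1
(Anticyclotomic Control Theorem) [arXiv Thm. 8, p. 11] combined with §3.5 display (3.5.d) [arXiv
p. 16] for an elliptic curve `E/ℚ`**, as the authors combine them in §7.4.1 (p. 30) and as restated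
in Castella 2018 Thm. 2.3 / Castella–Grossi–Lee–Skinner 2022 Thm. 5.1.1. Setting (verbatim, §2.1,
§3, §3.3): "let `p ≥ 3` be a fixed prime"; "`𝒦/ℚ` an imaginary quadratic field such that `p`
splits in `𝒦`: `p = v v̄`"; "`𝒦_∞` the anticyclotomic `ℤ_p`-extension of `𝒦`, `Γ = Gal(𝒦_∞/𝒦)`,
`Λ = 𝒪⟦Γ⟧`, `M = T ⊗_𝒪 Λ^` with `G_𝒦` acting via `ρ ⊗ Ψ⁻¹`, `X_ac^Σ(M) = Hom_𝒪(H¹_{𝓕_ac^Σ}(𝒦, M),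
L/𝒪)`" for the anticyclotomic Selmer structure "`H¹(𝒦_v̄, M)` if `w = v̄`; `H¹_ur(𝒦_w, M)` if
`w ∤ p∞` is split; `0` else" (§2.3.3); "Fix a topological generator `γ ∈ Γ`. We identify `𝒪⟦T⟧` with
`Λ` via `1 + T ↦ γ`." Thm. 3.3.1 (verbatim): "The `Λ`-module `X_ac^Σ(M)` is `Λ`-torsion, and if
`f_ac^Σ(T)` is a generator of its characteristic `Λ`-ideal, then `#𝒪/f_ac^Σ(0) = #H¹_{𝓕_ac}(𝒦, W) ·
C^Σ(W)`, where `C^Σ(W) = #H⁰(𝒦_v, W)·#H⁰(𝒦_v̄, W)·∏_{w∈S_p∖Σ, w split} #H¹_ur(𝒦_w, W)·∏_{w∈Σ}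
#H¹(𝒦_w, W)`" (`#H¹_ur(𝒦_w, W) = c_w^{(p)}(W)` "the `p`-parts of the local Tamagawa numbers",
§3.3.3), proved under §3.1's (geom), (pure), (sst), (τ-dual), (2-dim), (HT), (irred_𝒦), (corank 1),
(sur). (3.5.d) (verbatim): "In the special case that `A_f = E` is an elliptic curve, `p` is a prime
of good reduction, `𝒪 = ℤ_p`, and `P ∈ E(𝒦)` has infinite order … `#H¹_{𝓕_ac}(𝒦, E[p^∞]) =
#Ш(E/𝒦)[p^∞] · ( #ℤ_p/((1−a_p(E)+p)/p · log_{ω_E} P) / ([E(𝒦):ℤ·P]_p · #H⁰(𝒦_v, E[p^∞])) )²`",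
derived under (split), (good), (rank 1) `rank_ℤ E(𝒦) = 1`, (Ш-finite) `#Ш(E/𝒦)[p^∞] < ∞` and
(𝔭-irred) "`E[p]` is an irreducible `G_𝒦`-representation", which imply (corank 1), (sur),
(irred_𝒦) (§3.5 p. 15), the remaining assumptions holding for `E/ℚ` at `p ∤ N` ("(HT) always holds
for `2k = 2`"); no ordinarity and no `E(ℚ_p)[p] = 0` hypothesis. Combined at `Σ = ∅` (the two `#H⁰`
cancel, as in §7.4.1 p. 30): `ord_p f_ac(0) = ord_p #Ш(E/𝒦)[p^∞] + 2·(ord_p((1−a_p+p)/p·log_{ω_E} P)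
− ord_p[E(𝒦):ℤ·P]) + ord_p ∏_{w∣N, w split} c_w(E/𝒦)`. TRANSCRIBED (module docstring for the
dictionary) in the SPECIAL CASE where every `ℓ ∣ N` splits in `𝒦` (then `∏_{w∣N, w split} c_w =
∏_w c_w(E/𝒦)`; general (gen-H) form: TODO, needs `∏_{w∣N⁺} c_w` in Literature): `W` globally
minimal, `3 ≤ p`, `Good W p`; `K` imaginary quadratic with `p` split and every `ℓ ∣ N` split;
`ι : K →+* ℚ_p` and `v` the prime induced by `ι` — JSW's STRICT prime `v`, the log being taken on
`E(𝒦_v)`; `κ` anticyclotomic with topological generator `γ`; `X_ac(M) = AcSelmer.XAc (W.baseChange K)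
p κ v ∅ γ` (the Literature object of `Castella2018/AnticyclotomicSelmerDual.lean`, `K_∞`-formulation;
JSW's "`H¹_ur`" at split `w ∤ p` = "locally trivial" over `K_∞`); (irred_𝒦) =
`(W.baseChange K).HasIrreducibleModPGaloisRep p`; conclusion with `#ℤ_p/(x) = p^{ord_p x}`: torsion,
`Ch = (f)`, `f(0) ≠ 0`, `ord_p f(0) = ord_p #Ш(E/𝒦)[p^∞] + 2·((ord_p(1−a_p+p) − 1 + ord_p log_{ω_E}
P) − ord_p[E(𝒦):ℤP]) + ord_p ∏_w c_w(E/𝒦)` (`padicLogOrd W p ι P`; `(W.baseChange K).tamagawaProduct`,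
`c_w = 1` off `N`). PUBLISHED.
[cite: JetchevSkinnerWan2017, Thm. 3.3.1 (arXiv:1512.06894 Thm. 8, p. 11) with §3.5 (3.5.d) (arXiv p. 16, (eq:modabvar-ec)), §3.3.3 (arXiv Prop. 11, p. 12), §3.1 (p. 10), §2.3.3 (p. 7), §7.4.1 (p. 30)]
[cite: CastellaGrossiLeeSkinner2022, Thm. 5.1.1 and its proof ("the combination of Theorem 3.3.1 and equation (3.5.d) in [JSW]")]
[cite: Castella2018, Def. 2.2 and Thm. 2.3 (arXiv:1704.06608 p. 5) (the object `X_ac`; same theorem with `ε_p`)] -/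
def thm331_anticyclotomicControl : Prop :=
  ∀ (W : WeierstrassCurve ℚ) [W.IsElliptic] [W.IsGloballyMinimal] (p : ℕ) [Fact p.Prime],
    3 ≤ p → Good W p →
    ∀ (K : Type) [Field K] [NumberField K], IsImaginaryQuadratic K →
      SatisfiesHeegnerHypothesis p K → SatisfiesHeegnerHypothesis (W.conductorNorm ℤ) K →
      (W.baseChange K).HasIrreducibleModPGaloisRep p →
    ∀ (ι : K →+* ℚ_[p]) (v : HeightOneSpectrum (𝓞 K)),
      (∀ x : 𝓞 K, x ∈ v.asIdeal ↔ ‖ι (x : K)‖ < 1) →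
    ∀ (κ : ZpExtension K p), κ.IsAnticyclotomic →
    ∀ (γ : absoluteGaloisGroup K) [Fact (κ.IsTopGenerator γ)],
      (W.baseChange K).mordellWeilRank = 1 →
      Finite (AddCommGroup.primaryComponent (W.baseChange K).sha p) →
    ∀ (P : (W.baseChange K).toAffine.Point), ¬ IsOfFinAddOrder P →
      Module.IsTorsion (IwasawaAlgebra p) (AcSelmer.XAc (W.baseChange K) p κ v ∅ γ) ∧
      ∃ F : IwasawaAlgebra p,
        AcSelmer.XAc.charIdeal (W.baseChange K) p κ v ∅ γ = Ideal.span {F} ∧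
        PowerSeries.constantCoeff F ≠ 0 ∧
        ((PowerSeries.constantCoeff F).valuation : ℤ) =
          (padicValNat p (Nat.card (AddCommGroup.primaryComponent (W.baseChange K).sha p)) : ℤ) +
            2 * (((padicValInt p (1 - W.frobeniusTrace p + p) : ℤ) - 1 + padicLogOrd W p ι P) -
              (padicValNat p (AddSubgroup.zmultiples P).index : ℤ)) +
            (padicValNat p (W.baseChange K).tamagawaProduct : ℤ)

variable {W : WeierstrassCurve ℚ} [W.IsElliptic] [W.IsGloballyMinimal] {p : ℕ} [Fact p.Prime]

/-! ### Bookkeeping consumers -/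

/-- **Thm. 3.3.1 + (3.5.d) in the packaged currency** `AcSelmer.XAc.HasCharValuationAt … n` ("`X_ac`
is `Λ`-torsion with a generator `f`, `f(0) ≠ 0`, `ord_p f(0) = n`") `∧ n =` the printed right-hand
side — literally the body shape of the cell's Summits-side predicate `X11b.ControlOnTreeGoodAt p κ v
γ ι P` (Castella 2018 Thm. 2.3 with `ε_p = p⁻¹`, log at the strict prime), up to the Tamagawa
reading (`∏_w c_w(E/K)` here, `∏_{w∣N⁺} c_w` there; equal at a field where every `ℓ ∣ N` splits).
[cite: JetchevSkinnerWan2017, Thm. 3.3.1 with (3.5.d)] [cite: Castella2018, Thm. 2.3 (arXiv:1704.06608 p. 5)] -/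
theorem hasCharValuationAt_of_thm331 (h : thm331_anticyclotomicControl) (hp : 3 ≤ p)
    (hgood : Good W p) (K : Type) [Field K] [NumberField K] (hK : IsImaginaryQuadratic K)
    (hHp : SatisfiesHeegnerHypothesis p K) (hHN : SatisfiesHeegnerHypothesis (W.conductorNorm ℤ) K)
    (hirr : (W.baseChange K).HasIrreducibleModPGaloisRep p)
    (ι : K →+* ℚ_[p]) (v : HeightOneSpectrum (𝓞 K))
    (hv : ∀ x : 𝓞 K, x ∈ v.asIdeal ↔ ‖ι (x : K)‖ < 1)
    (κ : ZpExtension K p) (hκ : κ.IsAnticyclotomic)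
    (γ : absoluteGaloisGroup K) [Fact (κ.IsTopGenerator γ)]
    (hrk : (W.baseChange K).mordellWeilRank = 1)
    (hfin : Finite (AddCommGroup.primaryComponent (W.baseChange K).sha p))
    (P : (W.baseChange K).toAffine.Point) (hP : ¬ IsOfFinAddOrder P) :
    ∃ n : ℕ, AcSelmer.XAc.HasCharValuationAt (W.baseChange K) p κ v ∅ γ n ∧
      (n : ℤ) = (padicValNat p (Nat.card (AddCommGroup.primaryComponent (W.baseChange K).sha p)) : ℤ) +
        2 * (((padicValInt p (1 - W.frobeniusTrace p + p) : ℤ) - 1 + padicLogOrd W p ι P) -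
          (padicValNat p (AddSubgroup.zmultiples P).index : ℤ)) +
        (padicValNat p (W.baseChange K).tamagawaProduct : ℤ) := by
  obtain ⟨htors, F, hF, hF0, hval⟩ :=
    h W p hp hgood K hK hHp hHN hirr ι v hv κ hκ γ hrk hfin P hP
  exact ⟨(PowerSeries.constantCoeff F).valuation,
    AcSelmer.XAc.hasCharValuationAt_of_eq htors hF hF0 rfl, hval⟩

/-- **Every generator has the printed valuation**: granted Thm. 3.3.1 + (3.5.d), if `Ch(X_ac) = (g)`
for ANY `g ∈ Λ`, then `g(0) ≠ 0` and `ord_p g(0)` equals the printed right-hand side ("if `f_ac(T)`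
is a generator" is generator-independent: two generators differ by a unit of `Λ`, whose constant
term is a unit of `ℤ_p` — `AcSelmer.valuation_constantCoeff_eq_of_span_singleton_eq`).
[cite: JetchevSkinnerWan2017, Thm. 3.3.1 (arXiv Thm. 8, p. 11)] -/
theorem thm331_padicVal_eq_of_generator (h : thm331_anticyclotomicControl) (hp : 3 ≤ p)
    (hgood : Good W p) (K : Type) [Field K] [NumberField K] (hK : IsImaginaryQuadratic K)
    (hHp : SatisfiesHeegnerHypothesis p K) (hHN : SatisfiesHeegnerHypothesis (W.conductorNorm ℤ) K)
    (hirr : (W.baseChange K).HasIrreducibleModPGaloisRep p)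
    (ι : K →+* ℚ_[p]) (v : HeightOneSpectrum (𝓞 K))
    (hv : ∀ x : 𝓞 K, x ∈ v.asIdeal ↔ ‖ι (x : K)‖ < 1)
    (κ : ZpExtension K p) (hκ : κ.IsAnticyclotomic)
    (γ : absoluteGaloisGroup K) [Fact (κ.IsTopGenerator γ)]
    (hrk : (W.baseChange K).mordellWeilRank = 1)
    (hfin : Finite (AddCommGroup.primaryComponent (W.baseChange K).sha p))
    (P : (W.baseChange K).toAffine.Point) (hP : ¬ IsOfFinAddOrder P)
    (G : IwasawaAlgebra p) (hG : AcSelmer.XAc.charIdeal (W.baseChange K) p κ v ∅ γ = Ideal.span {G}) :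
    PowerSeries.constantCoeff G ≠ 0 ∧
      ((PowerSeries.constantCoeff G).valuation : ℤ) =
        (padicValNat p (Nat.card (AddCommGroup.primaryComponent (W.baseChange K).sha p)) : ℤ) +
          2 * (((padicValInt p (1 - W.frobeniusTrace p + p) : ℤ) - 1 + padicLogOrd W p ι P) -
            (padicValNat p (AddSubgroup.zmultiples P).index : ℤ)) +
          (padicValNat p (W.baseChange K).tamagawaProduct : ℤ) := by
  obtain ⟨-, F, hF, hF0, hval⟩ :=
    h W p hp hgood K hK hHp hHN hirr ι v hv κ hκ γ hrk hfin P hP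
  obtain ⟨hG0, hGF⟩ := AcSelmer.valuation_constantCoeff_eq_of_span_singleton_eq (hF.symm.trans hG) hF0
  exact ⟨hG0, by rw [hGF]; exact hval⟩

/-- **Internal consistency of the printed formula: the point `P` is arbitrary.** Granted Thm. 3.3.1
+ (3.5.d), for two points `P, P'` of infinite order `ord_p log_{ω_E} P − ord_p[E(K):ℤP] = ord_p
log_{ω_E} P' − ord_p[E(K):ℤP']` (the two instances describe the same number `ord_p f_ac(0)`,
`AcSelmer.XAc.HasCharValuationAt.unique`). [cite: JetchevSkinnerWan2017, §3.5 (3.5.d) ("`P ∈ E(𝒦)` has infinite order"; arXiv p. 16)] -/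
theorem logOrd_sub_index_eq_of_thm331 (h : thm331_anticyclotomicControl) (hp : 3 ≤ p)
    (hgood : Good W p) (K : Type) [Field K] [NumberField K] (hK : IsImaginaryQuadratic K)
    (hHp : SatisfiesHeegnerHypothesis p K) (hHN : SatisfiesHeegnerHypothesis (W.conductorNorm ℤ) K)
    (hirr : (W.baseChange K).HasIrreducibleModPGaloisRep p)
    (ι : K →+* ℚ_[p]) (v : HeightOneSpectrum (𝓞 K))
    (hv : ∀ x : 𝓞 K, x ∈ v.asIdeal ↔ ‖ι (x : K)‖ < 1)
    (κ : ZpExtension K p) (hκ : κ.IsAnticyclotomic)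
    (γ : absoluteGaloisGroup K) [Fact (κ.IsTopGenerator γ)]
    (hrk : (W.baseChange K).mordellWeilRank = 1)
    (hfin : Finite (AddCommGroup.primaryComponent (W.baseChange K).sha p))
    (P P' : (W.baseChange K).toAffine.Point) (hP : ¬ IsOfFinAddOrder P) (hP' : ¬ IsOfFinAddOrder P') :
    padicLogOrd W p ι P - (padicValNat p (AddSubgroup.zmultiples P).index : ℤ) =
      padicLogOrd W p ι P' - (padicValNat p (AddSubgroup.zmultiples P').index : ℤ) := by
  obtain ⟨n, hn, hne1⟩ :=
    hasCharValuationAt_of_thm331 h hp hgood K hK hHp hHN hirr ι v hv κ hκ γ hrk hfin P hP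
  obtain ⟨n', hn', hne2⟩ :=
    hasCharValuationAt_of_thm331 h hp hgood K hK hHp hHN hirr ι v hv κ hκ γ hrk hfin P' hP'
  obtain rfl : n = n' := hn.unique hn'
  omega

end Literature.NumberTheory.EllipticCurves.JetchevSkinnerWan2017

end
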